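import Summits.CriticalPhenomena.CardyFormulaZ2.Theses.CardySelfDualSegment
import Summits.CriticalPhenomena.CardyFormulaZ2.Theorems.CardyMagicRigidityLoopsToCrossingsStubComparisonGeometry
import Summits.CriticalPhenomena.CardyFormulaZ2.Theorems.CardyMagicRigidityLoopsToCrossingsStubCardyContinuity
import Literature.Probability.Percolation.CornerPercolation
import Literature.Probability.Percolation.CardyFormulaConformalInvariance
import Literature.Probability.Percolation.TriCrossingSandwich
import Literature.Probability.LatticeModels.TriangularLatticeProofs
import Literature.Probability.RandomPlanarGeometry.ImageUnivalent
import Literature.Probability.RandomPlanarGeometry.CollarGeometry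
import Literature.Barriers.CriticalPhenomena.EmbeddingModulusUniquenessProofs
import Summits.CriticalPhenomena.CardyFormulaZ2.Theorems.CardySelfDualSegmentSmirnovBasePointBondRealisation

/-!
# Crux `SmirnovBasePoint` (stmt-CriticalPhenomena-5474), line `Sketch`: stub `stub_ownerExtraction`

Owner extraction. Corner percolation `M_0` is site percolation `ω ⊆ ℤ²` on the triangular
lattice `triGraph` (vertex set `ℤ²`, `x ∼ y` iff `x, y` are `ℤ²`-neighbours or `y = x ± (1, -1)`)
drawn as bonds of `ℤ²`: the bond configuration `upTriangleConfig ω` opens exactly the east edge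
`{o, o + e₀}` and the north edge `{o, o + e₁}` of every open site `o ∈ ω`.

Hence every edge `{w, w'}` of an open bond path of `upTriangleConfig ω` has an *owner* `o ∈ ω`
with `{w, w'} = {o, o + e_j}` (`OwnerExtraction.exists_owner`); the owner is one of the two
endpoints of its edge, so it lies in any set `V` containing the vertices of the path. The owners
`o, o'` of two consecutive edges `{w, q}`, `{q, w'}` both sit at or just below the shared vertex
`q` (`o = q` or `o + e_j = q`), whence `o = o'` or `o ∼ o'` in `triGraph`: `o + e_j = o' + e_k`
with `j ≠ k` forces `o' = o ± (1, -1)` (`OwnerExtraction.eq_or_adj_of_apex`, using the identity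
`x + (1, -1) + e₁ = x + e₀` from the bond-realisation stub file). So the owners of
the edges of a nontrivial open bond path inside `V` form a `triGraph`-path of open sites inside
`V`, from the first vertex or a `triGraph`-neighbour of it to the last vertex or a
`triGraph`-neighbour of it (`stub_ownerExtraction`, by induction along the path:
`OwnerExtraction.owners_pathIn`).

Source: Bollobás–Riordan 2010 §2 (the model `M_0` / `H(p)` as site percolation on the triangular
lattice of corners); the path bookkeeping is folklore.
-/

noncomputable section

namespace Summit.CriticalPhenomena.CardyFormulaZ2.Cruxes.SmirnovBasePoint.ShearedSandwich

open Literature.Probability.RandomPlanarGeometry hiding cardyFunction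
open Literature.Probability.Percolation hiding cardyFunction
open Literature.Probability.LatticeModels
open Literature.Barriers.CriticalPhenomena
open Summit.CriticalPhenomena.CardyFormulaZ2.Cruxes.LoopsToCrossings.OracleSandwich
open Filter Topology Set MeasureTheory Metric

namespace OwnerExtraction

/-- **Owners.** Every edge `{q, q'}` of the open graph of `upTriangleConfig ω` is the east or
north edge `{o, o + e_k}` of an open site `o ∈ ω`, its *owner*, which is one of the two
endpoints `q`, `q'`. [folklore] -/
theorem exists_owner {ω : SiteConfig (Site 2)} {q q' : Site 2}
    (h : (openGraph (upTriangleConfig ω)).Adj q q') :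
    ∃ o ∈ ω, ∃ k : Fin 2,
      (o = q ∧ o + Pi.single k 1 = q') ∨ (o = q' ∧ o + Pi.single k 1 = q) := by
  rw [openGraph_adj] at h
  obtain ⟨⟨o, k⟩, ⟨ho, -⟩, he⟩ :
      s(q, q') ∈ Literature.Probability.Percolation.cornerEdge '' (ω ×ˢ Set.univ) := h.1
  exact ⟨o, ho, k, Sym2.eq_iff.1 he⟩

/-- Two sites `o`, `o'`, each equal to `q` or having `q` as an apex (`o + e_j = q`), coincide or
are `triGraph`-adjacent: `o + e_j = o' + e_k` with `j ≠ k` forces `o' = o ± (1, -1)`. [folklore] -/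
theorem eq_or_adj_of_apex {o o' q : Site 2}
    (ho : o = q ∨ ∃ j : Fin 2, o + Pi.single j 1 = q)
    (ho' : o' = q ∨ ∃ k : Fin 2, o' + Pi.single k 1 = q) : o = o' ∨ triGraph.Adj o o' := by
  rcases ho with rfl | ⟨j, rfl⟩
  · rcases ho' with rfl | ⟨k, rfl⟩
    · exact Or.inl rfl
    · exact Or.inr (zdGraph_le_triGraph ((zdGraph_adj_iff _ _).2 ⟨k, Or.inr rfl⟩))
  · rcases ho' with rfl | ⟨k, hk⟩
    · exact Or.inr (zdGraph_le_triGraph ((zdGraph_adj_iff _ _).2 ⟨j, Or.inl rfl⟩))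
    · have h2 : ∀ i : Fin 2, i = 0 ∨ i = 1 := by decide
      rcases h2 j with rfl | rfl <;> rcases h2 k with rfl | rfl
      · exact Or.inl (add_right_cancel hk).symm
      · -- `o' + e₁ = o + e₀`: `o' = o + (1, -1)`
        refine Or.inr ((triGraph_adj_iff _ _).2 (Or.inr (Or.inl ?_)))
        rw [← BondRealisation.add_triDiag_add_single_one o] at hk
        exact add_right_cancel hk
      · -- `o' + e₀ = o + e₁`: `o = o' + (1, -1)`
        refine Or.inr ((triGraph_adj_iff _ _).2 (Or.inr (Or.inr ?_)))
        rw [← BondRealisation.add_triDiag_add_single_one o'] at hk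
        exact (add_right_cancel hk).symm
      · exact Or.inl (add_right_cancel hk).symm

/-- **Owner extraction, inductive form.** Along an open bond path `u → ⋯ → q` of
`upTriangleConfig ω` inside `V`, either `q = u`, or the owners of its edges give a `triGraph`-path
of open sites of `V` from `u` or a `triGraph`-neighbour of `u` to the owner `o` of the last edge,
which is `q` or has `q` as an apex. [folklore] -/
theorem owners_pathIn {ω : SiteConfig (Site 2)} {V : Set (Site 2)} {u q : Site 2} (huV : u ∈ V)
    (h : Relation.ReflTransGen
      (fun p p' => (openGraph (upTriangleConfig ω)).Adj p p' ∧ p' ∈ V) u q) :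
    q = u ∨ ∃ a o : Site 2, (a = u ∨ triGraph.Adj u a) ∧ PathIn triGraph (V ∩ ω) a o ∧
      (o = q ∨ ∃ j : Fin 2, o + Pi.single j 1 = q) := by
  induction h with
  | refl => exact Or.inl rfl
  | @tail q q' hpath hstep ih =>
    have hqV : q ∈ V :=
      PathIn.right_mem (show PathIn (openGraph (upTriangleConfig ω)) V u q from ⟨huV, hpath⟩)
    obtain ⟨o', ho'ω, k, hk⟩ := exists_owner hstep.1
    -- the owner `o'` of the new edge lies in `V`, at or below `q`, and at or below `q'`
    have ho'V : o' ∈ V := by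
      rcases hk with ⟨rfl, -⟩ | ⟨rfl, -⟩
      exacts [hqV, hstep.2]
    have hq : o' = q ∨ ∃ j : Fin 2, o' + Pi.single j 1 = q := by
      rcases hk with ⟨h1, -⟩ | ⟨-, h2⟩
      exacts [Or.inl h1, Or.inr ⟨k, h2⟩]
    have hq' : o' = q' ∨ ∃ j : Fin 2, o' + Pi.single j 1 = q' := by
      rcases hk with ⟨-, h2⟩ | ⟨h1, -⟩
      exacts [Or.inr ⟨k, h2⟩, Or.inl h1]
    refine Or.inr ?_
    rcases ih with rfl | ⟨a, o, ha, hp, ho⟩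
    · -- first edge (or back at the start): start the owner path afresh at `o'`
      exact ⟨o', o', (eq_or_adj_of_apex (Or.inl rfl) hq).imp Eq.symm id,
        PathIn.refl ⟨ho'V, ho'ω⟩, hq'⟩
    · -- extend the owner path by the owner `o'` of the new edge
      exact ⟨a, o', ha, hp.trans (PathIn.of_eq_or_adj hp.right_mem ⟨ho'V, ho'ω⟩
        (eq_or_adj_of_apex ho hq)), hq'⟩

end OwnerExtraction

/-- **Stub D1 (owner extraction).** The owners of the edges of a nontrivial open bond path of
`upTriangleConfig ω` inside `V` form a `𝕋`-path of open sites inside `V`, starting at the first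
vertex or at a `𝕋`-neighbour of it and ending at the last vertex or at a `𝕋`-neighbour of it.
[folklore] -/
theorem stub_ownerExtraction : ∀ (ω : SiteConfig (Site 2)) (V : Set (Site 2)) (u v : Site 2),
    PathIn (openGraph (upTriangleConfig ω)) V u v → u ≠ v →
      ∃ a b : Site 2, (a = u ∨ triGraph.Adj u a) ∧ (b = v ∨ triGraph.Adj b v) ∧
        PathIn triGraph (V ∩ ω) a b := by
  intro ω V u v h huv
  obtain ⟨huV, hr⟩ := h
  rcases OwnerExtraction.owners_pathIn huV hr with rfl | ⟨a, o, ha, hp, ho⟩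
  · exact absurd rfl huv
  · refine ⟨a, o, ha, ?_, hp⟩
    rcases ho with rfl | ⟨j, rfl⟩
    · exact Or.inl rfl
    · exact Or.inr (zdGraph_le_triGraph ((zdGraph_adj_iff _ _).2 ⟨j, Or.inl rfl⟩))

end Summit.CriticalPhenomena.CardyFormulaZ2.Cruxes.SmirnovBasePoint.ShearedSandwich
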